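import Mathlib
import Summits.Ventures.PercRepro2.ThreeTermTvT

/-!
# The star world: laws on the eight configurations of three typed edges, the `(2,2,2)`-functional, and its Harris cone
(blind cell PercRepro2, night-3 g28, 2026-08-29; `proofs/NIGHT3-CERT.md` §37.6)

Let `S = {s₀, s₁, s₂}` be three typed edges of type `2` (a star at an unmarked vertex, or any three edges)
and `F` the other typed edges.  `TypedStarSplit.typedCount_split` writes `typedCount (F ∪ S) z τ K` as the
sum, over the `27` typed assignments of the three edges to the three copies, of the per-copy pinned
counts `T i j k = typedCount3 F (setOn S (cfg i) z) (setOn S (cfg j) z) (setOn S (cfg k) z) τ K`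
(`cfg i` = the star configuration with bits `i`).  The cubic `N_T μ = Σ T i j k μ i μ j μ k` on laws
`μ : Fin 8 → ℚ` has the `(2,2,2)`-functional `star8 N_T = Σ_{typed} T i j k` (the symmetrisation identity
`star8_cubic`).  Pushing a law forward to the partitions of the three ends (`pushf`, along `π8`: the open
star edges merge their ends) turns the `27` typed triples into the orbits `3·(⊥,⊤,⊤) + 6·Σ_p (⊥,p,⊤) +
6·(01,02,12)` (`star8_pull`), i.e. `star8 (g ∘ pushf) = bT2 g + tvt g` of `ThreeTermTvT`.

This file holds the star world: `typed8` (the `27` typed assignments), `π8` and `pushf` (the partition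
of the ends induced by a star configuration and the push-forward of laws), `B8` / `star8` (the polarisation
and the `(2,2,2)`-functional), the symmetrisation identity `star8_mono8`, the pulled-back Harris generators
`gen8 a s = μ a · hslack s (pushf μ)` as explicit monomial combinations (`gen8_eq`, through the bilinear
coefficients `hq` of the nine slacks), their `72` evaluations, the cone `InCone8` and
**`star8_nonneg_of_inCone8`**.  The companion `TypedStarCone.lean` applies it to `typedCount`.
Own work; standard axioms.
-/

namespace Summit.Ventures.PercRepro2

namespace TypedStar

open ThreeTerm

/-! ## The eight star configurations -/

/-- Bit `t` of `i`. -/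
def bit (t : ℕ) (i : Fin 8) : ℕ := i.val / 2 ^ t % 2

/-- The `(2,2,2)`-typed triples: every star edge open in exactly two of the three copies. -/
def typed8 (i j k : Fin 8) : Prop :=
  bit 0 i + bit 0 j + bit 0 k = 2 ∧ bit 1 i + bit 1 j + bit 1 k = 2 ∧ bit 2 i + bit 2 j + bit 2 k = 2

/-- `typed8` is decidable. -/
instance (i j k : Fin 8) : Decidable (typed8 i j k) := by unfold typed8; infer_instance

/-- `typed8` is invariant under swapping the first two copies. -/
lemma typed8_swap12 : ∀ i j k : Fin 8, typed8 i j k ↔ typed8 j i k := by decide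

/-- `typed8` is invariant under swapping the last two copies. -/
lemma typed8_swap23 : ∀ i j k : Fin 8, typed8 i j k ↔ typed8 i k j := by decide

/-- The partition of the three ends induced by the star configuration `i`: the open edges merge their
ends (`0 = ⊥`, `1 = 01`, `2 = 02`, `3 = 12`, `4 = ⊤`). -/
def π8 (i : Fin 8) : Fin 5 :=
  if i.val = 3 then 1 else if i.val = 5 then 2 else if i.val = 6 then 3 else if i.val = 7 then 4 else 0

/-- The unit law on `Fin 8`. -/
def e8 (i : Fin 8) : Fin 8 → ℚ := fun j => if j.val = i.val then 1 else 0

/-- Unit laws are nonnegative coordinatewise. -/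
lemma e8_nonneg (i j : Fin 8) : 0 ≤ e8 i j := by
  unfold e8; split_ifs <;> norm_num

/-- The push-forward of a law on star configurations to the partitions of the ends. -/
def pushf (μ : Fin 8 → ℚ) : Fin 5 → ℚ := fun p => ∑ i : Fin 8, if π8 i = p then μ i else 0

/-- `pushf` is additive. -/
lemma pushf_add (μ ν : Fin 8 → ℚ) : pushf (μ + ν) = pushf μ + pushf ν := by
  funext p
  simp only [pushf, Pi.add_apply, ← Finset.sum_add_distrib]
  refine Finset.sum_congr rfl fun i _ => ?_
  split_ifs <;> ring

/-- `pushf` of a unit law is the unit law at the image partition. -/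
lemma pushf_e8 (i : Fin 8) : pushf (e8 i) = e (π8 i) := by
  funext p
  simp only [pushf]
  rw [Fintype.sum_eq_single i (fun j hj => by simp [e8, Fin.val_eq_val, hj])]
  simp only [e8, e, if_true]
  by_cases h : π8 i = p
  · subst h; simp
  · have h' : ¬ p.val = (π8 i).val := fun hv => h (Fin.ext hv).symm
    simp [h, h']

/-- The symmetric trilinear polarisation of a cubic on `Fin 8 → ℚ`. -/
def B8 (N : (Fin 8 → ℚ) → ℚ) (x y z : Fin 8 → ℚ) : ℚ :=
  (N (x + y + z) - N (x + y) - N (x + z) - N (y + z) + N x + N y + N z) / 6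

/-- The `(2,2,2)`-star functional: the polarisation summed over the typed triples. -/
def star8 (N : (Fin 8 → ℚ) → ℚ) : ℚ :=
  ∑ i : Fin 8, ∑ j : Fin 8, ∑ k : Fin 8, if typed8 i j k then B8 N (e8 i) (e8 j) (e8 k) else 0

/-- The cubic monomial on `Fin 8`. -/
def mono8 (i j k : Fin 8) : (Fin 8 → ℚ) → ℚ := fun μ => μ i * μ j * μ k

/-- `B8` of a pulled-back cubic is `B` of the cubic at the pushed-forward laws. -/
lemma B8_comp_pushf (g : (Fin 5 → ℚ) → ℚ) (x y z : Fin 8 → ℚ) :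
    B8 (fun μ => g (pushf μ)) x y z = B g (pushf x) (pushf y) (pushf z) := by
  simp only [B8, B, pushf_add]

/-- `B8` of a finite sum. -/
lemma B8_sum {ι : Type*} (t : Finset ι) (f : ι → (Fin 8 → ℚ) → ℚ) (x y z : Fin 8 → ℚ) :
    B8 (fun μ => ∑ g ∈ t, f g μ) x y z = ∑ g ∈ t, B8 (f g) x y z := by
  unfold B8
  rw [← Finset.sum_div]
  congr 1
  simp only [Finset.sum_add_distrib, Finset.sum_sub_distrib]

/-- `B8` of a scalar multiple. -/
lemma B8_smul (c : ℚ) (f : (Fin 8 → ℚ) → ℚ) (x y z : Fin 8 → ℚ) :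
    B8 (fun μ => c * f μ) x y z = c * B8 f x y z := by
  simp only [B8]; ring

/-- `B8` of a sum of two cubics. -/
lemma B8_add (f g : (Fin 8 → ℚ) → ℚ) (x y z : Fin 8 → ℚ) :
    B8 (fun μ => f μ + g μ) x y z = B8 f x y z + B8 g x y z := by
  simp only [B8]; ring

/-- An `if` distributes over a finite sum. -/
lemma ite_sum {ι : Type*} {c : Prop} [Decidable c] (t : Finset ι) (f : ι → ℚ) :
    (if c then ∑ g ∈ t, f g else 0) = ∑ g ∈ t, if c then f g else 0 := by
  split_ifs <;> simp

/-- `star8` of a finite sum. -/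
lemma star8_sum {ι : Type*} (t : Finset ι) (f : ι → (Fin 8 → ℚ) → ℚ) :
    star8 (fun μ => ∑ g ∈ t, f g μ) = ∑ g ∈ t, star8 (f g) := by
  simp only [star8, B8_sum, ite_sum]
  symm
  rw [Finset.sum_comm]
  refine Finset.sum_congr rfl fun i _ => ?_
  rw [Finset.sum_comm]
  refine Finset.sum_congr rfl fun j _ => ?_
  rw [Finset.sum_comm]

/-- `star8` of a scalar multiple. -/
lemma star8_smul (c : ℚ) (f : (Fin 8 → ℚ) → ℚ) : star8 (fun μ => c * f μ) = c * star8 f := by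
  simp only [star8, B8_smul, Finset.mul_sum]
  refine Finset.sum_congr rfl fun i _ => Finset.sum_congr rfl fun j _ => Finset.sum_congr rfl fun k _ => ?_
  split_ifs <;> simp

/-- `star8` of a sum of two cubics. -/
lemma star8_add (f g : (Fin 8 → ℚ) → ℚ) : star8 (fun μ => f μ + g μ) = star8 f + star8 g := by
  simp only [star8, B8_add]
  rw [← Finset.sum_add_distrib]
  refine Finset.sum_congr rfl fun i _ => ?_
  rw [← Finset.sum_add_distrib]
  refine Finset.sum_congr rfl fun j _ => ?_
  rw [← Finset.sum_add_distrib]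
  refine Finset.sum_congr rfl fun k _ => ?_
  split_ifs <;> simp

/-- The polarisation of a monomial at three laws: the symmetrised product. -/
lemma B8_mono8 (i j k : Fin 8) (x y z : Fin 8 → ℚ) :
    B8 (mono8 i j k) x y z = (x i * y j * z k + x i * z j * y k + y i * x j * z k + y i * z j * x k +
      z i * x j * y k + z i * y j * x k) / 6 := by
  simp only [B8, mono8, Pi.add_apply]; ring

/-- `e8 a i = 1` iff `a = i`, else `0`. -/
lemma e8_apply (a i : Fin 8) : e8 a i = if a = i then 1 else 0 := by
  unfold e8
  simp only [Fin.val_eq_val, eq_comm]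

/-- A typed sum of a product of three unit-law indicators is the typed indicator of the index triple. -/
lemma sum_typed_ind (i j k : Fin 8) :
    (∑ a : Fin 8, ∑ b : Fin 8, ∑ c : Fin 8, if typed8 a b c then e8 a i * e8 b j * e8 c k else 0) =
      if typed8 i j k then 1 else 0 := by
  have h1 : ∀ a, a ≠ i →
      (∑ b : Fin 8, ∑ c : Fin 8, if typed8 a b c then e8 a i * e8 b j * e8 c k else 0) = 0 := by
    intro a ha
    refine Finset.sum_eq_zero fun b _ => Finset.sum_eq_zero fun c _ => ?_
    simp [e8_apply, ha]
  rw [Fintype.sum_eq_single i h1]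
  have h2 : ∀ b, b ≠ j → (∑ c : Fin 8, if typed8 i b c then e8 i i * e8 b j * e8 c k else 0) = 0 := by
    intro b hb
    refine Finset.sum_eq_zero fun c _ => ?_
    simp [e8_apply, hb]
  rw [Fintype.sum_eq_single j h2]
  have h3 : ∀ c, c ≠ k → (if typed8 i j c then e8 i i * e8 j j * e8 c k else 0) = 0 := by
    intro c hc
    simp [e8_apply, hc]
  rw [Fintype.sum_eq_single k h3]
  simp [e8_apply]

/-- **The symmetrisation identity for monomials**: `star8 (mono8 i j k)` is the typed indicator. -/
lemma star8_mono8 (i j k : Fin 8) : star8 (mono8 i j k) = if typed8 i j k then 1 else 0 := by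
  unfold star8
  simp only [B8_mono8]
  have key : ∀ a b c : Fin 8, (if typed8 a b c then
      (e8 a i * e8 b j * e8 c k + e8 a i * e8 c j * e8 b k + e8 b i * e8 a j * e8 c k +
        e8 b i * e8 c j * e8 a k + e8 c i * e8 a j * e8 b k + e8 c i * e8 b j * e8 a k) / 6 else 0) =
      ((if typed8 a b c then e8 a i * e8 b j * e8 c k else 0) +
        (if typed8 a b c then e8 a i * e8 b k * e8 c j else 0) +
        (if typed8 a b c then e8 a j * e8 b i * e8 c k else 0) +
        (if typed8 a b c then e8 a k * e8 b i * e8 c j else 0) +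
        (if typed8 a b c then e8 a j * e8 b k * e8 c i else 0) +
        (if typed8 a b c then e8 a k * e8 b j * e8 c i else 0)) / 6 := by
    intro a b c
    split_ifs <;> ring
  simp only [key, ← Finset.sum_div, Finset.sum_add_distrib]
  rw [sum_typed_ind i j k, sum_typed_ind i k j, sum_typed_ind j i k, sum_typed_ind k i j,
    sum_typed_ind j k i, sum_typed_ind k j i]
  have t1 : typed8 i k j ↔ typed8 i j k := (typed8_swap23 i j k).symm
  have t2 : typed8 j i k ↔ typed8 i j k := (typed8_swap12 i j k).symm
  have t3 : typed8 k i j ↔ typed8 i j k := (typed8_swap12 k i j).trans (typed8_swap23 i j k).symm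
  have t4 : typed8 j k i ↔ typed8 i j k := (typed8_swap23 j k i).trans (typed8_swap12 i j k).symm
  have t5 : typed8 k j i ↔ typed8 i j k := (typed8_swap12 k j i).trans t4
  simp only [t1, t2, t3, t4, t5]
  split_ifs <;> norm_num

/-! ## The Harris generators in the star world -/

/-- The symmetric coefficient of `μ p μ q` (each unordered pair once) with value `v`. -/
def sym (a b : Fin 5) (v : ℚ) (p q : Fin 5) : ℚ :=
  if (p = a ∧ q = b) ∨ (p = b ∧ q = a) then (if a = b then v else v / 2) else 0

/-- The bilinear coefficients of the nine homogenised Harris slacks: `hslack s μ = Σ_{p q} hq s p q μ p μ q`. -/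
def hq (s : Fin 9) (p q : Fin 5) : ℚ :=
  match s with
  | 0 => sym 0 4 1 p q + sym 3 4 1 p q - sym 1 2 1 p q
  | 1 => sym 0 4 1 p q + sym 2 4 1 p q - sym 1 3 1 p q
  | 2 => sym 0 4 1 p q + sym 1 4 1 p q - sym 2 3 1 p q
  | 3 => sym 0 4 1 p q - sym 1 2 1 p q - sym 1 3 1 p q
  | 4 => sym 0 4 1 p q - sym 1 2 1 p q - sym 2 3 1 p q
  | 5 => sym 0 4 1 p q - sym 1 3 1 p q - sym 2 3 1 p q
  | 6 => sym 0 1 1 p q + sym 0 4 1 p q - sym 2 3 1 p q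
  | 7 => sym 0 2 1 p q + sym 0 4 1 p q - sym 1 3 1 p q
  | 8 => sym 0 3 1 p q + sym 0 4 1 p q - sym 1 2 1 p q

/-- The slacks as bilinear forms. -/
lemma hslack_eq_hq (s : Fin 9) (μ : Fin 5 → ℚ) : hslack s μ = ∑ p : Fin 5, ∑ q : Fin 5, hq s p q * μ p * μ q := by
  fin_cases s <;> simp [hslack, hq, sym, Fin.sum_univ_succ] <;> ring

/-- The pulled-back Harris generator in the star world: `μ a · hslack s (pushf μ)`. -/
def gen8 (a : Fin 8) (s : Fin 9) : (Fin 8 → ℚ) → ℚ := fun μ => μ a * hslack s (pushf μ)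

/-- A sum over `p` of a fibre indicator of `π8` collapses. -/
lemma sum_fibre (b : Fin 8) (f : Fin 5 → ℚ) : (∑ p : Fin 5, if π8 b = p then f p else 0) = f (π8 b) := by
  rw [Fintype.sum_eq_single (π8 b) (fun p hp => by simp [Ne.symm hp])]
  simp

/-- A double sum over `(p, q)` of a fibre indicator of `(π8 b, π8 c)` collapses. -/
lemma sum_fibre2 (b c : Fin 8) (f : Fin 5 → Fin 5 → ℚ) :
    (∑ p : Fin 5, ∑ q : Fin 5, if π8 b = p ∧ π8 c = q then f p q else 0) = f (π8 b) (π8 c) := by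
  rw [Fintype.sum_eq_single (π8 b) (fun p hp => Finset.sum_eq_zero fun q _ => by simp [Ne.symm hp])]
  rw [Fintype.sum_eq_single (π8 c) (fun q hq => by simp [Ne.symm hq])]
  simp

/-- Commuting the two star indices past the two partition indices. -/
lemma sum4_swap (f : Fin 8 → Fin 8 → Fin 5 → Fin 5 → ℚ) :
    (∑ b : Fin 8, ∑ c : Fin 8, ∑ p : Fin 5, ∑ q : Fin 5, f b c p q) =
      ∑ p : Fin 5, ∑ q : Fin 5, ∑ b : Fin 8, ∑ c : Fin 8, f b c p q :=
  calc (∑ b : Fin 8, ∑ c : Fin 8, ∑ p : Fin 5, ∑ q : Fin 5, f b c p q)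
      = ∑ b : Fin 8, ∑ p : Fin 5, ∑ c : Fin 8, ∑ q : Fin 5, f b c p q :=
        Finset.sum_congr rfl fun _ _ => Finset.sum_comm
    _ = ∑ p : Fin 5, ∑ b : Fin 8, ∑ c : Fin 8, ∑ q : Fin 5, f b c p q := Finset.sum_comm
    _ = ∑ p : Fin 5, ∑ b : Fin 8, ∑ q : Fin 5, ∑ c : Fin 8, f b c p q :=
        Finset.sum_congr rfl fun _ _ => Finset.sum_congr rfl fun _ _ => Finset.sum_comm
    _ = ∑ p : Fin 5, ∑ q : Fin 5, ∑ b : Fin 8, ∑ c : Fin 8, f b c p q :=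
        Finset.sum_congr rfl fun _ _ => Finset.sum_comm

/-- `gen8 a s` is an explicit combination of the monomials `mono8 a b c`. -/
lemma gen8_eq (a : Fin 8) (s : Fin 9) :
    gen8 a s = fun μ => ∑ b : Fin 8, ∑ c : Fin 8, hq s (π8 b) (π8 c) * mono8 a b c μ := by
  funext μ
  simp only [gen8, hslack_eq_hq, mono8]
  -- expand the right-hand side through the fibre indicators and commute the sums
  have hr : ∀ b c : Fin 8, hq s (π8 b) (π8 c) * (μ a * μ b * μ c) =
      ∑ p : Fin 5, ∑ q : Fin 5, if π8 b = p ∧ π8 c = q then hq s p q * (μ a * μ b * μ c) else 0 := by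
    intro b c
    rw [sum_fibre2 b c (fun p q => hq s p q * (μ a * μ b * μ c))]
  simp only [hr]
  rw [sum4_swap]
  -- the left-hand side, fibre by fibre
  rw [Finset.mul_sum]
  refine Finset.sum_congr rfl fun p _ => ?_
  rw [Finset.mul_sum]
  refine Finset.sum_congr rfl fun q _ => ?_
  simp only [pushf]
  rw [mul_assoc, Finset.sum_mul_sum, Finset.mul_sum, Finset.mul_sum]
  refine Finset.sum_congr rfl fun b _ => ?_
  rw [Finset.mul_sum, Finset.mul_sum]
  refine Finset.sum_congr rfl fun c _ => ?_
  split_ifs <;> simp_all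
  ring

/-- `star8` of a pulled-back Harris generator: the typed sum of the bilinear coefficients. -/
lemma star8_gen8 (a : Fin 8) (s : Fin 9) :
    star8 (gen8 a s) = ∑ b : Fin 8, ∑ c : Fin 8, hq s (π8 b) (π8 c) * (if typed8 a b c then 1 else 0) := by
  rw [gen8_eq, star8_sum]
  refine Finset.sum_congr rfl fun b _ => ?_
  rw [star8_sum]
  refine Finset.sum_congr rfl fun c _ => ?_
  rw [star8_smul, star8_mono8]

/-- The typed sums of the bilinear coefficients of slack `0` are nonnegative (8 evaluations). -/
lemma gen8_sum_nonneg_0 (a : Fin 8) :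
    0 ≤ ∑ b : Fin 8, ∑ c : Fin 8, hq 0 (π8 b) (π8 c) * (if typed8 a b c then (1 : ℚ) else 0) := by
  fin_cases a <;> simp [Fin.sum_univ_succ, hq, sym, π8, typed8, bit]

/-- The typed sums of the bilinear coefficients of slack `1` are nonnegative (8 evaluations). -/
lemma gen8_sum_nonneg_1 (a : Fin 8) :
    0 ≤ ∑ b : Fin 8, ∑ c : Fin 8, hq 1 (π8 b) (π8 c) * (if typed8 a b c then (1 : ℚ) else 0) := by
  fin_cases a <;> simp [Fin.sum_univ_succ, hq, sym, π8, typed8, bit]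

/-- The typed sums of the bilinear coefficients of slack `2` are nonnegative (8 evaluations). -/
lemma gen8_sum_nonneg_2 (a : Fin 8) :
    0 ≤ ∑ b : Fin 8, ∑ c : Fin 8, hq 2 (π8 b) (π8 c) * (if typed8 a b c then (1 : ℚ) else 0) := by
  fin_cases a <;> simp [Fin.sum_univ_succ, hq, sym, π8, typed8, bit]

/-- The typed sums of the bilinear coefficients of slack `3` are nonnegative (8 evaluations). -/
lemma gen8_sum_nonneg_3 (a : Fin 8) :
    0 ≤ ∑ b : Fin 8, ∑ c : Fin 8, hq 3 (π8 b) (π8 c) * (if typed8 a b c then (1 : ℚ) else 0) := by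
  fin_cases a <;> simp [Fin.sum_univ_succ, hq, sym, π8, typed8, bit]

/-- The typed sums of the bilinear coefficients of slack `4` are nonnegative (8 evaluations). -/
lemma gen8_sum_nonneg_4 (a : Fin 8) :
    0 ≤ ∑ b : Fin 8, ∑ c : Fin 8, hq 4 (π8 b) (π8 c) * (if typed8 a b c then (1 : ℚ) else 0) := by
  fin_cases a <;> simp [Fin.sum_univ_succ, hq, sym, π8, typed8, bit]

/-- The typed sums of the bilinear coefficients of slack `5` are nonnegative (8 evaluations). -/
lemma gen8_sum_nonneg_5 (a : Fin 8) :
    0 ≤ ∑ b : Fin 8, ∑ c : Fin 8, hq 5 (π8 b) (π8 c) * (if typed8 a b c then (1 : ℚ) else 0) := by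
  fin_cases a <;> simp [Fin.sum_univ_succ, hq, sym, π8, typed8, bit]

/-- The typed sums of the bilinear coefficients of slack `6` are nonnegative (8 evaluations). -/
lemma gen8_sum_nonneg_6 (a : Fin 8) :
    0 ≤ ∑ b : Fin 8, ∑ c : Fin 8, hq 6 (π8 b) (π8 c) * (if typed8 a b c then (1 : ℚ) else 0) := by
  fin_cases a <;> simp [Fin.sum_univ_succ, hq, sym, π8, typed8, bit]
  norm_num

/-- The typed sums of the bilinear coefficients of slack `7` are nonnegative (8 evaluations). -/
lemma gen8_sum_nonneg_7 (a : Fin 8) :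
    0 ≤ ∑ b : Fin 8, ∑ c : Fin 8, hq 7 (π8 b) (π8 c) * (if typed8 a b c then (1 : ℚ) else 0) := by
  fin_cases a <;> simp [Fin.sum_univ_succ, hq, sym, π8, typed8, bit]
  norm_num

/-- The typed sums of the bilinear coefficients of slack `8` are nonnegative (8 evaluations). -/
lemma gen8_sum_nonneg_8 (a : Fin 8) :
    0 ≤ ∑ b : Fin 8, ∑ c : Fin 8, hq 8 (π8 b) (π8 c) * (if typed8 a b c then (1 : ℚ) else 0) := by
  fin_cases a <;> simp [Fin.sum_univ_succ, hq, sym, π8, typed8, bit]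
  norm_num

/-- The typed sums of the bilinear coefficients are nonnegative (72 evaluations). -/
lemma gen8_sum_nonneg (a : Fin 8) (s : Fin 9) :
    0 ≤ ∑ b : Fin 8, ∑ c : Fin 8, hq s (π8 b) (π8 c) * (if typed8 a b c then (1 : ℚ) else 0) := by
  fin_cases s
  · exact gen8_sum_nonneg_0 a
  · exact gen8_sum_nonneg_1 a
  · exact gen8_sum_nonneg_2 a
  · exact gen8_sum_nonneg_3 a
  · exact gen8_sum_nonneg_4 a
  · exact gen8_sum_nonneg_5 a
  · exact gen8_sum_nonneg_6 a
  · exact gen8_sum_nonneg_7 a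
  · exact gen8_sum_nonneg_8 a

/-- Every pulled-back Harris generator has nonnegative `star8`. -/
lemma star8_gen8_nonneg (a : Fin 8) (s : Fin 9) : 0 ≤ star8 (gen8 a s) := by
  rw [star8_gen8]; exact gen8_sum_nonneg a s

/-- Every monomial has nonnegative `star8`. -/
lemma star8_mono8_nonneg (i j k : Fin 8) : 0 ≤ star8 (mono8 i j k) := by
  rw [star8_mono8]; split_ifs <;> norm_num

/-- **The Harris cone in the star world**: nonnegative combinations of the `512` monomials and the `72`
pulled-back Harris generators `μ a · hslack s (pushf μ)`. -/
def InCone8 (N : (Fin 8 → ℚ) → ℚ) : Prop :=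
  ∃ (lm : Fin 8 → Fin 8 → Fin 8 → ℚ) (lh : Fin 8 → Fin 9 → ℚ),
    (∀ i j k, 0 ≤ lm i j k) ∧ (∀ a s, 0 ≤ lh a s) ∧
    ∀ μ, N μ = (∑ i, ∑ j, ∑ k, lm i j k * mono8 i j k μ) + ∑ a, ∑ s, lh a s * gen8 a s μ

/-- **The `(2,2,2)`-functional is nonnegative on the cone.** -/
theorem star8_nonneg_of_inCone8 (N : (Fin 8 → ℚ) → ℚ) (h : InCone8 N) : 0 ≤ star8 N := by
  obtain ⟨lm, lh, hm, hh, heq⟩ := h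
  have hN : N = fun μ => (∑ i, ∑ j, ∑ k, lm i j k * mono8 i j k μ) + ∑ a, ∑ s, lh a s * gen8 a s μ :=
    funext heq
  rw [hN, star8_add]
  apply add_nonneg
  · rw [star8_sum]
    refine Finset.sum_nonneg fun i _ => ?_
    rw [star8_sum]
    refine Finset.sum_nonneg fun j _ => ?_
    rw [star8_sum]
    refine Finset.sum_nonneg fun k _ => ?_
    rw [star8_smul]
    exact mul_nonneg (hm i j k) (star8_mono8_nonneg i j k)
  · rw [star8_sum]
    refine Finset.sum_nonneg fun a _ => ?_
    rw [star8_sum]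
    refine Finset.sum_nonneg fun s _ => ?_
    rw [star8_smul]
    exact mul_nonneg (hh a s) (star8_gen8_nonneg a s)

end TypedStar

end Summit.Ventures.PercRepro2
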